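import Mathlib.RingTheory.DedekindDomain.Factorization
import Mathlib.RingTheory.DedekindDomain.AdicValuation
import Mathlib.RingTheory.ClassGroup.Basic
import Mathlib.NumberTheory.NumberField.ClassNumber
import HarnessLib

/-!
# Elements with `n`-divisible valuations: the map to the `n`-torsion of the class group,
# and the count `2m + 1 ≤ #(𝓞ˣ/𝓞ˣ³) · #Cl[3]` for `m` independent such elements modulo cubes

Topic `NumberTheory/NumberFields`.  Theorem-only file (no definition, no named fact).

Let `R` be a Dedekind domain with fraction field `K` and `n ≥ 1`.  The elements `x ∈ Kˣ` all of
whose valuations are divisible by `n` — equivalently, whose principal fractional ideal `(x)` is an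
`n`-th power `(x) = 𝔞ⁿ` — form a subgroup `W ≤ Kˣ` (the "virtual `n`-th powers", the Selmer group
`K(∅, n)` before passing to `Kˣ/Kˣⁿ`), and `x ↦ [𝔞]` is a homomorphism `W → Cl(R)[n]` whose kernel
is `Rˣ · Kˣⁿ`: the exact sequence `1 → Rˣ/Rˣⁿ → K(∅, n) → Cl(R)[n] → 1` of Kummer theory
(Cohen, *Advanced Topics in Computational Number Theory*, GTM 193, Prop. 5.2.5 with `S = ∅`;
Washington, *Introduction to Cyclotomic Fields*, proof of Thm. 10.10: "`V = {β : (β) = 𝔟³}/K^{×3}`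
… `dim V = rank₃ Cl + rank E/E³`").  Mathlib has the Selmer group `IsDedekindDomain.selmerGroup`
and the injection `selmerGroup.fromUnitLift_injective` but not the map to the class group
(`Mathlib/RingTheory/DedekindDomain/SelmerGroup.lean`, "TODO: maps in the sequence").

* `valuation_eq_exp_neg_count` — the dictionary `v(x) = exp (−count_v (x))` between the adic
  valuation of `x ∈ K` and the exponent of `v` in the factorisation of the fractional ideal `(x)`;
* `exists_subgroup_monoidHom_classGroup_of_dvd_valuation` — the subgroup `W` and the
  homomorphism `φ : W → Cl(R)` with `φ(x)ⁿ = 1` and `φ(x) = 1 ↔ x ∈ Rˣ · Kˣⁿ`;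
* `two_mul_card_add_one_le_of_dvd_valuation` — for a number field `K`: if `θ₁, …, θ_m ∈ Kˣ`
  have all valuations divisible by `3`, are not cubes, and are pairwise independent modulo cubes
  (`θ_i ∉ θ_j^{±1} K^{×3}` for `i ≠ j`), then `2m + 1 ≤ #(𝓞_Kˣ/𝓞_Kˣ³) · #Cl(K)[3]` — the
  counting form ("`(3^{dim V} − 1)/2` lines") used in Scholz's reflection theorem
  (`Literature.NumberTheory.QuadraticFields.Scholz1932_reflection`).

## References

* H. Cohen, *Advanced Topics in Computational Number Theory*, GTM 193 (2000), Prop. 5.2.5.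
* L. C. Washington, *Introduction to Cyclotomic Fields*, GTM 83, 2nd ed. (1997), proof of
  Thm. 10.10. [Washington1997]
-/

noncomputable section

open IsDedekindDomain IsDedekindDomain.HeightOneSpectrum WithZero FractionalIdeal Function
open scoped nonZeroDivisors NumberField

namespace Literature.NumberTheory.NumberFields

section Dedekind

variable {R : Type*} [CommRing R] [IsDedekindDomain R] (K : Type*) [Field K] [Algebra R K]
  [IsFractionRing R K]

/-- **Valuation vs. factorisation exponent**: for `x ≠ 0` in the fraction field of a Dedekind
domain, `v(x) = exp (−count_v ((x)))`, where `count_v` is the exponent of `v` in the factorisation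
of the principal fractional ideal `(x)` (Mathlib `FractionalIdeal.count`). [folklore] -/
theorem valuation_eq_exp_neg_count (v : HeightOneSpectrum R) {x : K} (hx : x ≠ 0) :
    v.valuation K x = exp (-count K v (spanSingleton R⁰ x)) := by
  obtain ⟨n, d, hdm, rfl⟩ := IsFractionRing.div_surjective (A := R) x
  have hd : d ≠ 0 := nonZeroDivisors.ne_zero hdm
  have hn : n ≠ 0 := by
    rintro rfl
    exact hx (by rw [map_zero, zero_div])
  have h0 : spanSingleton R⁰ (algebraMap R K n / algebraMap R K d) ≠ 0 := by
    rwa [Ne, spanSingleton_eq_zero_iff]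
  have hI : spanSingleton R⁰ (algebraMap R K n / algebraMap R K d) =
      spanSingleton R⁰ ((algebraMap R K) d)⁻¹ * ↑(Ideal.span {n} : Ideal R) := by
    rw [coeIdeal_span_singleton, spanSingleton_mul_spanSingleton]
    congr 1
    rw [div_eq_mul_inv, mul_comm]
  rw [count_well_defined K v h0 hI, map_div₀, valuation_of_algebraMap, valuation_of_algebraMap,
    intValuation_if_neg _ hn, intValuation_if_neg _ hd, ← exp_sub]
  congr 1
  ring

/-- For `x ≠ 0`: `n ∣ log v(x)` for all `v` iff `n ∣ count_v ((x))` for all `v`. [folklore] -/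
theorem forall_dvd_log_valuation_iff_forall_dvd_count (n : ℤ) {x : K} (hx : x ≠ 0) :
    (∀ v : HeightOneSpectrum R, n ∣ log (v.valuation K x)) ↔
      ∀ v : HeightOneSpectrum R, n ∣ count K v (spanSingleton R⁰ x) := by
  refine forall_congr' fun v => ?_
  rw [valuation_eq_exp_neg_count K v hx, log_exp, dvd_neg]

/-- The finitely supported family `v ↦ v ^ (count_v (x) / n)`. [folklore] -/
theorem hasFiniteMulSupport_zpow_count_div (n : ℤ) (x : K) :
    HasFiniteMulSupport fun v : HeightOneSpectrum R =>
      (v.asIdeal : FractionalIdeal R⁰ K) ^ (count K v (spanSingleton R⁰ x) / n) := by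
  refine (Filter.eventually_cofinite.mp (finite_factors (spanSingleton R⁰ x))).subset ?_
  intro v hv h0
  exact hv (by simp only [h0, Int.zero_ediv, zpow_zero])

/-- **The `n`-th root ideal.** If `n ∣ count_v ((x))` for every `v` (and `n ≠ 0`, `x ≠ 0`), the
fractional ideal `𝔞 = ∏ v ^ (count_v (x) / n)` satisfies `𝔞ⁿ = (x)`. [folklore] -/
theorem finprod_zpow_count_div_pow (n : ℕ) {x : K} (hx : x ≠ 0)
    (hdvd : ∀ v : HeightOneSpectrum R, (n : ℤ) ∣ count K v (spanSingleton R⁰ x)) :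
    (∏ᶠ v : HeightOneSpectrum R,
        (v.asIdeal : FractionalIdeal R⁰ K) ^ (count K v (spanSingleton R⁰ x) / n)) ^ n =
      spanSingleton R⁰ x := by
  rw [finprod_pow (hasFiniteMulSupport_zpow_count_div K n x)]
  conv_rhs => rw [← finprod_heightOneSpectrum_factorization' K
    ((spanSingleton_ne_zero_iff).mpr hx)]
  refine finprod_congr fun v => ?_
  rw [← zpow_natCast, ← zpow_mul, Int.ediv_mul_cancel (hdvd v)]

/-- The `n`-th root ideal is nonzero. [folklore] -/
theorem finprod_zpow_count_div_ne_zero {n : ℕ} (hn : n ≠ 0) {x : K} (hx : x ≠ 0)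
    (hdvd : ∀ v : HeightOneSpectrum R, (n : ℤ) ∣ count K v (spanSingleton R⁰ x)) :
    (∏ᶠ v : HeightOneSpectrum R,
        (v.asIdeal : FractionalIdeal R⁰ K) ^ (count K v (spanSingleton R⁰ x) / n)) ≠ 0 := by
  intro h
  have := finprod_zpow_count_div_pow K n hx hdvd
  rw [h, zero_pow hn] at this
  exact (spanSingleton_ne_zero_iff.mpr hx) this.symm

/-- The `n`-th root ideal is multiplicative. [folklore] -/
theorem finprod_zpow_count_div_mul {n : ℕ} {x y : K} (hx : x ≠ 0) (hy : y ≠ 0)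
    (hdx : ∀ v : HeightOneSpectrum R, (n : ℤ) ∣ count K v (spanSingleton R⁰ x)) :
    (∏ᶠ v : HeightOneSpectrum R,
        (v.asIdeal : FractionalIdeal R⁰ K) ^ (count K v (spanSingleton R⁰ (x * y)) / n)) =
      (∏ᶠ v : HeightOneSpectrum R,
        (v.asIdeal : FractionalIdeal R⁰ K) ^ (count K v (spanSingleton R⁰ x) / n)) *
      ∏ᶠ v : HeightOneSpectrum R,
        (v.asIdeal : FractionalIdeal R⁰ K) ^ (count K v (spanSingleton R⁰ y) / n) := by
  rw [← finprod_mul_distrib (hasFiniteMulSupport_zpow_count_div K n x)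
    (hasFiniteMulSupport_zpow_count_div K n y)]
  refine finprod_congr fun v => ?_
  rw [← zpow_add₀ (coeIdeal_ne_zero.mpr v.ne_bot), ← spanSingleton_mul_spanSingleton,
    count_mul K v (spanSingleton_ne_zero_iff.mpr hx) (spanSingleton_ne_zero_iff.mpr hy),
    Int.add_ediv_of_dvd_left (hdx v)]

/-- For an `n`-th power `x = zⁿ` the `n`-th root ideal is `(z)`. [folklore] -/
theorem finprod_zpow_count_div_of_pow {n : ℕ} (hn : n ≠ 0) {z : K} (hz : z ≠ 0) :
    (∏ᶠ v : HeightOneSpectrum R,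
        (v.asIdeal : FractionalIdeal R⁰ K) ^ (count K v (spanSingleton R⁰ (z ^ n)) / n)) =
      spanSingleton R⁰ z := by
  conv_rhs => rw [← finprod_heightOneSpectrum_factorization' K
    ((spanSingleton_ne_zero_iff).mpr hz)]
  refine finprod_congr fun v => ?_
  rw [← spanSingleton_pow, count_pow, Int.mul_ediv_cancel_left _ (Int.natCast_ne_zero.mpr hn)]

/-- For a unit `u ∈ Rˣ`: `v(u) = 1`. [folklore] -/
theorem valuation_units_map_eq_one (v : HeightOneSpectrum R) (u : Rˣ) :
    v.valuation K ((Units.map (algebraMap R K : R →* K) u : Kˣ) : K) = 1 := by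
  rw [Units.coe_map, MonoidHom.coe_coe, valuation_eq_one_iff_notMem]
  exact fun h => v.isPrime.ne_top (Ideal.eq_top_of_isUnit_mem _ h u.isUnit)

omit [IsDedekindDomain R] in
/-- For a unit `u ∈ Rˣ`: the fractional ideal `(u)` is `1`. [folklore] -/
theorem spanSingleton_units_eq_one (u : Rˣ) :
    spanSingleton R⁰ (algebraMap R K (u : R)) = 1 := by
  rw [← coeIdeal_span_singleton, Ideal.span_singleton_eq_top.mpr u.isUnit, coeIdeal_top]

/-- **The map to the class group (Kummer theory / the Selmer sequence).**  For `n ≥ 1` the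
elements `x ∈ Kˣ` with `n ∣ log v(x)` for every finite place `v` form a subgroup `W ≤ Kˣ`, and
`x ↦ [𝔞]`, `(x) = 𝔞ⁿ`, is a homomorphism `φ : W → Cl(R)` with `φ(x)ⁿ = 1`, whose kernel is
`Rˣ · Kˣⁿ` (the exact sequence `1 → Rˣ/Rˣⁿ → K(∅,n) → Cl(R)[n] → 1`; Cohen, GTM 193,
Prop. 5.2.5; Washington, proof of Thm. 10.10). [folklore] -/
theorem exists_subgroup_monoidHom_classGroup_of_dvd_valuation {n : ℕ} (hn : n ≠ 0) :
    ∃ W : Subgroup Kˣ,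
      (∀ x : Kˣ, x ∈ W ↔ ∀ v : HeightOneSpectrum R, (n : ℤ) ∣ log (v.valuation K x)) ∧
      ∃ φ : W →* ClassGroup R, (∀ x, φ x ^ n = 1) ∧
        ∀ x : W, φ x = 1 ↔
          ∃ (u : Rˣ) (z : Kˣ), (x : Kˣ) = Units.map (algebraMap R K : R →* K) u * z ^ n := by
  classical
  -- the subgroup
  let W : Subgroup Kˣ :=
    { carrier := {x | ∀ v : HeightOneSpectrum R, (n : ℤ) ∣ log (v.valuation K x)}
      one_mem' := fun v => by simp only [Units.val_one, map_one, log_one, dvd_zero]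
      mul_mem' := fun {x y} hx hy v => by
        simp only [Set.mem_setOf_eq, Units.val_mul, map_mul] at hx hy ⊢
        rw [log_mul ((Valuation.ne_zero_iff _).mpr x.ne_zero)
          ((Valuation.ne_zero_iff _).mpr y.ne_zero)]
        exact dvd_add (hx v) (hy v)
      inv_mem' := fun {x} hx v => by
        simp only [Set.mem_setOf_eq, Units.val_inv_eq_inv_val, map_inv₀, log_inv, dvd_neg] at hx ⊢
        exact hx v }
  have hmemW : ∀ x : Kˣ, x ∈ W ↔ ∀ v : HeightOneSpectrum R, (n : ℤ) ∣ log (v.valuation K x) :=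
    fun x => Iff.rfl
  -- counts are divisible by `n` on `W`
  have hcount : ∀ x : W, ∀ v : HeightOneSpectrum R,
      (n : ℤ) ∣ count K v (spanSingleton R⁰ ((x : Kˣ) : K)) := fun x =>
    (forall_dvd_log_valuation_iff_forall_dvd_count K n (x : Kˣ).ne_zero).mp x.2
  -- the `n`-th root ideal
  let J : W → FractionalIdeal R⁰ K := fun x => ∏ᶠ v : HeightOneSpectrum R,
    (v.asIdeal : FractionalIdeal R⁰ K) ^ (count K v (spanSingleton R⁰ ((x : Kˣ) : K)) / n)
  have hJ0 : ∀ x, J x ≠ 0 := fun x =>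
    finprod_zpow_count_div_ne_zero K hn (x : Kˣ).ne_zero (hcount x)
  have hJpow : ∀ x, J x ^ n = spanSingleton R⁰ ((x : Kˣ) : K) := fun x =>
    finprod_zpow_count_div_pow K n (x : Kˣ).ne_zero (hcount x)
  have hJmul : ∀ x y, J (x * y) = J x * J y := fun x y => by
    simp only [J, Subgroup.coe_mul, Units.val_mul]
    exact finprod_zpow_count_div_mul K (x : Kˣ).ne_zero (y : Kˣ).ne_zero (hcount x)
  have hJ1 : J 1 = 1 := by
    simp only [J, Subgroup.coe_one, Units.val_one, spanSingleton_one, count_one, Int.zero_ediv,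
      zpow_zero, finprod_one]
  -- as a homomorphism to the units of the monoid of fractional ideals
  let Ju : W →* (FractionalIdeal R⁰ K)ˣ :=
    { toFun := fun x => Units.mk0 (J x) (hJ0 x)
      map_one' := Units.ext (by rw [Units.val_mk0, Units.val_one, hJ1])
      map_mul' := fun x y => Units.ext (by simp only [Units.val_mk0, Units.val_mul, hJmul]) }
  have hJu : ∀ x, ((Ju x : (FractionalIdeal R⁰ K)ˣ) : FractionalIdeal R⁰ K) = J x := fun x => rfl
  -- the homomorphism to the class group
  let φ : W →* ClassGroup R := (ClassGroup.mk K).comp Ju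
  have hφ : ∀ x, φ x = ClassGroup.mk K (Ju x) := fun x => rfl
  -- `φ = 1` exactly when `J` is principal, i.e. `(x) = (y ^ n)`
  have hφ1 : ∀ x : W, φ x = 1 ↔ ∃ y : K, J x = spanSingleton R⁰ y := by
    intro x
    rw [hφ, ClassGroup.mk_eq_one_iff, hJu]
    constructor
    · intro h
      haveI := h
      exact ⟨_, eq_spanSingleton_of_principal (J x)⟩
    · rintro ⟨y, hy⟩
      exact ⟨⟨y, by rw [hy, coe_spanSingleton]⟩⟩
  refine ⟨W, hmemW, φ, fun x => ?_, fun x => ?_⟩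
  · -- `φ x ^ n = [(x)] = 1`
    rw [← map_pow, hφ1]
    refine ⟨((x : Kˣ) : K), ?_⟩
    have : ∀ k : ℕ, J (x ^ k) = J x ^ k := fun k => by
      induction k with
      | zero => rw [pow_zero, pow_zero, hJ1]
      | succ m ih => rw [pow_succ, pow_succ, hJmul, ih]
    rw [this, hJpow]
  · rw [hφ1]
    constructor
    · -- kernel ⊆ `Rˣ · Kˣⁿ`
      rintro ⟨y, hJx⟩
      have hy0 : y ≠ 0 := by
        rintro rfl
        exact hJ0 x (by rw [hJx, spanSingleton_zero])
      have hxy : spanSingleton R⁰ (y ^ n) = spanSingleton R⁰ ((x : Kˣ) : K) := by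
        rw [← spanSingleton_pow, ← hJx, hJpow]
      obtain ⟨u, hu⟩ := (spanSingleton_eq_spanSingleton (S := R⁰)).mp hxy
      refine ⟨u, Units.mk0 y hy0, Units.ext ?_⟩
      rw [Units.val_mul, Units.coe_map, MonoidHom.coe_coe, Units.val_pow_eq_pow_val, Units.val_mk0,
        ← hu, Units.smul_def, Algebra.smul_def]
    · -- `Rˣ · Kˣⁿ ⊆` kernel
      rintro ⟨u, z, hxz⟩
      have huW : Units.map (algebraMap R K : R →* K) u ∈ W := fun v => by
        rw [valuation_units_map_eq_one, log_one]
        exact dvd_zero _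
      have hzW : z ^ n ∈ W := fun v => by
        rw [Units.val_pow_eq_pow_val, map_pow, log_pow, nsmul_eq_mul]
        exact dvd_mul_right _ _
      have hx : x = ⟨_, huW⟩ * ⟨_, hzW⟩ := Subtype.ext hxz
      have h1 : J ⟨_, huW⟩ = 1 := by
        simp only [J, Units.coe_map, MonoidHom.coe_coe]
        refine finprod_eq_one_of_forall_eq_one fun v => ?_
        rw [spanSingleton_units_eq_one, count_one, Int.zero_ediv, zpow_zero]
      have h2 : J ⟨_, hzW⟩ = spanSingleton R⁰ (z : K) := by
        simp only [J, Units.val_pow_eq_pow_val]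
        exact finprod_zpow_count_div_of_pow K hn z.ne_zero
      refine ⟨(z : K), ?_⟩
      rw [hx, hJmul, h1, h2, one_mul]

end Dedekind

/-! ### Counting independent elements modulo cubes in a number field -/

section NumberField

/-- In a commutative group: `a⁻¹ = a z³` forces `a = (a z)³` (a cube). [folklore] -/
theorem eq_pow_three_of_inv_eq_mul_pow {G : Type*} [CommGroup G] {a z : G}
    (h : a⁻¹ = a * z ^ 3) : a = (a * z) ^ 3 := by
  have h1 : a * (a * z ^ 3) = 1 := by rw [← h, mul_inv_cancel]
  have : (a * z) ^ 3 = a * (a * (a * z ^ 3)) := by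
    rw [mul_pow, pow_succ, pow_two]; ac_rfl
  rw [this, h1, mul_one]

/-- In a commutative group: `a = a⁻¹ z³` forces `a = (z² a⁻¹)³` (a cube). [folklore] -/
theorem eq_pow_three_of_eq_inv_mul_pow {G : Type*} [CommGroup G] {a z : G}
    (h : a = a⁻¹ * z ^ 3) : a = (z ^ 2 * a⁻¹) ^ 3 := by
  have hz : a * a = z ^ 3 :=
    calc a * a = a * (a⁻¹ * z ^ 3) := by rw [← h]
      _ = z ^ 3 := mul_inv_cancel_left a _
  have h6 : z ^ 6 = (a * a) * (a * a) := by
    rw [show (6 : ℕ) = 3 + 3 from rfl, pow_add, ← hz]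
  rw [mul_pow, ← pow_mul, show 2 * 3 = 6 from rfl, h6]
  group

variable (K : Type*) [Field K] [NumberField K]

/-- **Counting lines of virtual cubes** (the count in Scholz's reflection theorem; Washington,
*Introduction to Cyclotomic Fields*, proof of Thm. 10.10: the Kummer generators of the unramified
cubic extensions give distinct lines in `V = {β : (β) = 𝔟³}/K^{×3}`, and
`#V = #Cl[3] · #(E/E³)`).  Let `θ_i ∈ Kˣ` (`i ∈ ι`, finite) have all valuations divisible by
`3`, be non-cubes, and be pairwise independent modulo cubes: `θ_i ∈ θ_j^{±1} · K^{×3} ⇒ i = j`.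
Then `2 · #ι + 1 ≤ #(𝓞_Kˣ/𝓞_Kˣ³) · #Cl(𝓞_K)[3]`: the `2 #ι + 1` classes `1, θ_i^{±1}` are
distinct in `W/K^{×3}`, `W` the group of virtual cubes, and
`#(W/K^{×3}) = #(ker φ / K^{×3}) · #(im φ) ≤ #(𝓞ˣ/𝓞ˣ³) · #Cl[3]` for the map `φ` of
`exists_subgroup_monoidHom_classGroup_of_dvd_valuation`. [cite: Washington1997, Thm 10.10 (proof)] -/
theorem two_mul_card_add_one_le_of_dvd_valuation {ι : Type*} [Finite ι] (θ : ι → Kˣ)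
    (hval : ∀ i (v : HeightOneSpectrum (𝓞 K)), (3 : ℤ) ∣ log (v.valuation K (θ i : K)))
    (hnc : ∀ i (z : Kˣ), θ i ≠ z ^ 3)
    (hind : ∀ i j (z : Kˣ), θ i = θ j * z ^ 3 ∨ θ i = (θ j)⁻¹ * z ^ 3 → i = j)
    [Finite ((𝓞 K)ˣ ⧸ (powMonoidHom 3 : (𝓞 K)ˣ →* (𝓞 K)ˣ).range)] :
    2 * Nat.card ι + 1 ≤ Nat.card ((𝓞 K)ˣ ⧸ (powMonoidHom 3 : (𝓞 K)ˣ →* (𝓞 K)ˣ).range) *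
      Nat.card {c : ClassGroup (𝓞 K) // c ^ 3 = 1} := by
  classical
  obtain ⟨W, hW, φ, hφ3, hker⟩ :=
    exists_subgroup_monoidHom_classGroup_of_dvd_valuation (R := 𝓞 K) K (n := 3) three_ne_zero
  -- the cubes `C ≤ K₁ = ker φ ≤ W`
  set C : Subgroup Kˣ := (powMonoidHom 3 : Kˣ →* Kˣ).range with hC
  have hmemC : ∀ x : Kˣ, x ∈ C ↔ ∃ z : Kˣ, z ^ 3 = x := fun x => by
    simp only [hC, MonoidHom.mem_range, powMonoidHom_apply]
  have hCW : C ≤ W := by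
    rintro _ ⟨z, rfl⟩
    rw [hW]
    intro v
    rw [powMonoidHom_apply, Units.val_pow_eq_pow_val, map_pow, log_pow, nsmul_eq_mul]
    exact dvd_mul_right _ _
  set K₁ : Subgroup Kˣ := φ.ker.map W.subtype with hK₁
  have hK₁W : K₁ ≤ W := Subgroup.map_subtype_le _
  have hmapW : ∀ u : (𝓞 K)ˣ, Units.map (algebraMap (𝓞 K) K : 𝓞 K →* K) u ∈ W := fun u => by
    rw [hW]
    intro v
    rw [valuation_units_map_eq_one, log_one]
    exact dvd_zero _
  have hmapK₁ : ∀ u : (𝓞 K)ˣ, Units.map (algebraMap (𝓞 K) K : 𝓞 K →* K) u ∈ K₁ := fun u => by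
    refine ⟨⟨_, hmapW u⟩, ?_, rfl⟩
    rw [SetLike.mem_coe, MonoidHom.mem_ker, hker]
    exact ⟨u, 1, by rw [one_pow, mul_one]⟩
  have hCK₁ : C ≤ K₁ := by
    rintro _ ⟨z, rfl⟩
    refine ⟨⟨z ^ 3, hCW ⟨z, rfl⟩⟩, ?_, rfl⟩
    rw [SetLike.mem_coe, MonoidHom.mem_ker, hker]
    exact ⟨1, z, by rw [map_one, one_mul]⟩
  -- `[W : K₁] = #im φ ≤ #Cl[3]`
  have h1 : K₁.relIndex W = Nat.card φ.range := by
    rw [Subgroup.relIndex, ← Subgroup.comap_subtype, hK₁,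
      Subgroup.comap_map_eq_self_of_injective W.subtype_injective, Subgroup.index_ker]
  have h1' : Nat.card φ.range ≤ Nat.card {c : ClassGroup (𝓞 K) // c ^ 3 = 1} := by
    refine Nat.card_le_card_of_injective (fun c => ⟨c.1, ?_⟩) fun a b h => ?_
    · obtain ⟨x, hx⟩ := c.2
      rw [← hx]
      exact hφ3 x
    · have h' := congrArg Subtype.val h
      exact Subtype.ext h'
  have h1ne : K₁.relIndex W ≠ 0 := by
    rw [h1]
    exact Nat.card_pos.ne'
  -- `[K₁ : C] ≤ #(𝓞ˣ/𝓞ˣ³)`: `u ↦ [u]` maps `𝓞ˣ/𝓞ˣ³` onto `K₁/C`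
  let f₀ : (𝓞 K)ˣ →* K₁ :=
    (Units.map (algebraMap (𝓞 K) K : 𝓞 K →* K)).codRestrict K₁ hmapK₁
  have hf₀ : ∀ u, ((f₀ u : K₁) : Kˣ) = Units.map (algebraMap (𝓞 K) K : 𝓞 K →* K) u :=
    fun u => rfl
  let g : (𝓞 K)ˣ →* K₁ ⧸ C.subgroupOf K₁ := (QuotientGroup.mk' _).comp f₀
  have hg : ∀ u, g u = QuotientGroup.mk (f₀ u) := fun u => rfl
  have hgsurj : Function.Surjective g := by
    intro y
    obtain ⟨⟨x, hx⟩, rfl⟩ := QuotientGroup.mk_surjective y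
    obtain ⟨w, hwker, rfl⟩ := Subgroup.mem_map.mp hx
    rw [MonoidHom.mem_ker, hker] at hwker
    obtain ⟨u, z, hwz⟩ := hwker
    refine ⟨u, ?_⟩
    rw [hg, QuotientGroup.eq, Subgroup.mem_subgroupOf, hmemC]
    refine ⟨z, ?_⟩
    rw [Subgroup.coe_mul, Subgroup.coe_inv, hf₀]
    change z ^ 3 = _ * (w : Kˣ)
    rw [hwz, inv_mul_cancel_left]
  have hgker : (powMonoidHom 3 : (𝓞 K)ˣ →* (𝓞 K)ˣ).range ≤ g.ker := by
    rintro _ ⟨u, rfl⟩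
    rw [MonoidHom.mem_ker, powMonoidHom_apply, map_pow, hg, ← QuotientGroup.mk_pow,
      QuotientGroup.eq_one_iff, Subgroup.mem_subgroupOf, hmemC]
    exact ⟨Units.map (algebraMap (𝓞 K) K : 𝓞 K →* K) u, by rw [Subgroup.coe_pow, hf₀]⟩
  have hsurj : Function.Surjective (QuotientGroup.lift _ g hgker) := by
    intro y
    obtain ⟨u, rfl⟩ := hgsurj y
    exact ⟨QuotientGroup.mk u, rfl⟩
  have h2 : C.relIndex K₁ ≤ Nat.card ((𝓞 K)ˣ ⧸ (powMonoidHom 3 : (𝓞 K)ˣ →* (𝓞 K)ˣ).range) :=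
    Nat.card_le_card_of_surjective _ hsurj
  have h2ne : C.relIndex K₁ ≠ 0 := by
    haveI : Finite (K₁ ⧸ C.subgroupOf K₁) := Finite.of_surjective _ hsurj
    exact Nat.card_pos.ne'
  -- hence `[W : C] ≤ #(𝓞ˣ/𝓞ˣ³) · #Cl[3]`, and `W/C` is finite
  have hCW' : C.relIndex W = C.relIndex K₁ * K₁.relIndex W :=
    (Subgroup.relIndex_mul_relIndex C K₁ W hCK₁ hK₁W).symm
  have hbound : C.relIndex W ≤ Nat.card ((𝓞 K)ˣ ⧸ (powMonoidHom 3 : (𝓞 K)ˣ →* (𝓞 K)ˣ).range) *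
      Nat.card {c : ClassGroup (𝓞 K) // c ^ 3 = 1} := by
    rw [hCW', h1]
    exact Nat.mul_le_mul h2 h1'
  refine le_trans ?_ hbound
  haveI : Fintype (W ⧸ C.subgroupOf W) :=
    Subgroup.fintypeOfIndexNeZero (by rw [← Subgroup.relIndex, hCW']; exact mul_ne_zero h2ne h1ne)
  -- the `2 #ι + 1` distinct classes `1, θ_i, θ_i⁻¹`
  let w : ι → W := fun i => ⟨θ i, (hW _).mpr (hval i)⟩
  have key : ∀ a b : W, (QuotientGroup.mk a : W ⧸ C.subgroupOf W) = QuotientGroup.mk b ↔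
      ∃ z : Kˣ, (b : Kˣ) = a * z ^ 3 := by
    intro a b
    rw [QuotientGroup.eq, Subgroup.mem_subgroupOf, hmemC, Subgroup.coe_mul, Subgroup.coe_inv]
    simp only [eq_inv_mul_iff_mul_eq]
    exact ⟨fun ⟨z, hz⟩ => ⟨z, hz.symm⟩, fun ⟨z, hz⟩ => ⟨z, hz.symm⟩⟩
  have hwi : ∀ i, ((w i : W) : Kˣ) = θ i := fun i => rfl
  have hmk1 : (1 : W ⧸ C.subgroupOf W) = QuotientGroup.mk 1 := rfl
  let e : (ι ⊕ ι) ⊕ Unit → W ⧸ C.subgroupOf W :=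
    Sum.elim (Sum.elim (fun i => QuotientGroup.mk (w i)) (fun i => QuotientGroup.mk (w i)⁻¹))
      (fun _ => 1)
  have hinj : Function.Injective e := by
    rintro ((i | i) | u) ((j | j) | u') hab
    · -- `θ_i = θ_j`
      obtain ⟨z, hz⟩ := (key _ _).mp hab
      rw [hwi, hwi] at hz
      rw [hind j i z (Or.inl hz)]
    · -- `θ_i = θ_j⁻¹`: forces `i = j`, and then `θ_i` is a cube
      obtain ⟨z, hz⟩ := (key _ _).mp hab
      rw [Subgroup.coe_inv, hwi, hwi] at hz
      have hij : i = j := by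
        refine hind i j z⁻¹ (Or.inr ?_)
        rw [inv_pow, hz, mul_inv_cancel_right]
      subst hij
      exact absurd (eq_pow_three_of_inv_eq_mul_pow hz) (hnc i _)
    · -- `θ_i = 1`
      change (QuotientGroup.mk (w i) : W ⧸ C.subgroupOf W) = 1 at hab
      rw [hmk1] at hab
      obtain ⟨z, hz⟩ := (key _ _).mp hab
      rw [hwi, Subgroup.coe_one, eq_comm, mul_eq_one_iff_eq_inv, ← inv_pow] at hz
      exact absurd hz (hnc i z⁻¹)
    · -- `θ_i⁻¹ = θ_j`
      obtain ⟨z, hz⟩ := (key _ _).mp hab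
      rw [Subgroup.coe_inv, hwi, hwi] at hz
      have hji : j = i := hind j i z (Or.inr hz)
      subst hji
      exact absurd (eq_pow_three_of_eq_inv_mul_pow hz) (hnc j _)
    · -- `θ_i⁻¹ = θ_j⁻¹`
      obtain ⟨z, hz⟩ := (key _ _).mp hab
      rw [Subgroup.coe_inv, Subgroup.coe_inv, hwi, hwi] at hz
      have hij : i = j := by
        refine hind i j z (Or.inl ?_)
        rw [← inv_inv (θ j), hz, mul_inv_rev, inv_inv, mul_comm ((z ^ 3)⁻¹) (θ i),
          inv_mul_cancel_right]
      rw [hij]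
    · -- `θ_i⁻¹ = 1`
      change (QuotientGroup.mk (w i)⁻¹ : W ⧸ C.subgroupOf W) = 1 at hab
      rw [hmk1] at hab
      obtain ⟨z, hz⟩ := (key _ _).mp hab
      rw [Subgroup.coe_inv, hwi, Subgroup.coe_one, eq_comm, inv_mul_eq_one] at hz
      exact absurd hz (hnc i z)
    · -- `1 = θ_j`
      change (1 : W ⧸ C.subgroupOf W) = QuotientGroup.mk (w j) at hab
      rw [hmk1] at hab
      obtain ⟨z, hz⟩ := (key _ _).mp hab
      rw [hwi, Subgroup.coe_one, one_mul] at hz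
      exact absurd hz (hnc j z)
    · -- `1 = θ_j⁻¹`
      change (1 : W ⧸ C.subgroupOf W) = QuotientGroup.mk (w j)⁻¹ at hab
      rw [hmk1] at hab
      obtain ⟨z, hz⟩ := (key _ _).mp hab
      rw [Subgroup.coe_inv, hwi, Subgroup.coe_one, one_mul, inv_eq_iff_eq_inv, ← inv_pow] at hz
      exact absurd hz (hnc j z⁻¹)
    · rfl
  calc 2 * Nat.card ι + 1 = Nat.card ((ι ⊕ ι) ⊕ Unit) := by
        rw [Nat.card_sum, Nat.card_sum, Nat.card_unique (α := Unit)]; ring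
    _ ≤ Nat.card (W ⧸ C.subgroupOf W) := Nat.card_le_card_of_injective e hinj
    _ = C.relIndex W := rfl

end NumberField

end Literature.NumberTheory.NumberFields

end
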